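import Summits.CriticalPhenomena.PercolationContinuityZ3.Theorems.PercNearOneGluingNoHeavyLowerTailSahiThreeCopyCellY6bMasks1
import Summits.CriticalPhenomena.PercolationContinuityZ3.Theorems.PercNearOneGluingNoHeavyLowerTailSahiThreeCopyHitPairsSix

/-!
# `NoHeavyLowerTail` (crux stmt-CriticalPhenomena-4575), Sahi programme: ★★★ **`LawGood 6 π 1_{Y6b}` AT EVERY FRONT PROFILE**

Support file (Sahi cell, seat `prim-sahi-p1`, generation 65; `--supports stmt-CriticalPhenomena-4575`).  Assembly: the interior table (masks `prof6 m`,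
`…CellY6bMasks*`) and the boundary (up-set sections on five coordinates, `frontGood_six_of_boundary`).
COMPUTATIONAL content inherited (cell checks, section identities). [this work]
-/

namespace Summit.CriticalPhenomena.PercolationContinuityZ3.Theorems.SahiThreeCopy

open Finset Function Literature.Combinatorics.Sahi2008
open scoped BigOperators

/-- ★★ `LawGood 6 (prof6 m) 1_{Y6b}` for EVERY interior front profile (all 64 masks). [this work] -/
theorem lawGood_Y6b_prof (m : Fin 64) : LawGood 6 (prof6 m) (setInd Y6bSet) := by
  fin_cases m
  · exact lawGood_Y6b111111
  · exact lawGood_Y6bm1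
  · exact lawGood_Y6b121111
  · exact lawGood_Y6b221111
  · exact lawGood_Y6bm4
  · exact lawGood_Y6bm5
  · exact lawGood_Y6bm6
  · exact lawGood_Y6bm7
  · exact lawGood_Y6bm8
  · exact lawGood_Y6bm9
  · exact lawGood_Y6bm10
  · exact lawGood_Y6bm11
  · exact lawGood_Y6bm12
  · exact lawGood_Y6bm13
  · exact lawGood_Y6bm14
  · exact lawGood_Y6bm15
  · exact lawGood_Y6b111121
  · exact lawGood_Y6bm17
  · exact lawGood_Y6b121121
  · exact lawGood_Y6b221121
  · exact lawGood_Y6bm20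
  · exact lawGood_Y6bm21
  · exact lawGood_Y6bm22
  · exact lawGood_Y6bm23
  · exact lawGood_Y6b111221
  · exact lawGood_Y6bm25
  · exact lawGood_Y6b121221
  · exact lawGood_Y6b221221
  · exact lawGood_Y6b112221
  · exact lawGood_Y6bm29
  · exact lawGood_Y6b122221
  · exact lawGood_Y6b222221
  · exact lawGood_Y6b111112
  · exact lawGood_Y6bm33
  · exact lawGood_Y6b121112
  · exact lawGood_Y6b221112
  · exact lawGood_Y6bm36
  · exact lawGood_Y6bm37
  · exact lawGood_Y6bm38
  · exact lawGood_Y6bm39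
  · exact lawGood_Y6bm40
  · exact lawGood_Y6bm41
  · exact lawGood_Y6bm42
  · exact lawGood_Y6bm43
  · exact lawGood_Y6bm44
  · exact lawGood_Y6bm45
  · exact lawGood_Y6bm46
  · exact lawGood_Y6bm47
  · exact lawGood_Y6b111122
  · exact lawGood_Y6bm49
  · exact lawGood_Y6b121122
  · exact lawGood_Y6b221122
  · exact lawGood_Y6bm52
  · exact lawGood_Y6bm53
  · exact lawGood_Y6bm54
  · exact lawGood_Y6bm55
  · exact lawGood_Y6b111222
  · exact lawGood_Y6bm57
  · exact lawGood_Y6b121222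
  · exact lawGood_Y6b221222
  · exact lawGood_Y6b112222
  · exact lawGood_Y6bm61
  · exact lawGood_Y6b122222
  · exact lawGood_Y6b222222

/-- ★★★ **`LawGood 6 π 1_{Y6b}` at EVERY front profile** (interior: the table; boundary: sections are up-sets on five coordinates). [this work] -/
theorem lawGood_Y6b_all (π : Fin 6 → ℕ) : LawGood 6 π (setInd Y6bSet) :=
  lawGood_all_of_interior_of_boundary (k := 6) (f := setInd Y6bSet)
    (fun m hm => lawGood_Y6b_prof ⟨m, hm⟩)
    (fun π i hi => lawGood_of_frontGood (frontGood_six_of_boundary π i hi isUpperSet_Y6bSet)) π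

end Summit.CriticalPhenomena.PercolationContinuityZ3.Theorems.SahiThreeCopy
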